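import Summits.HodgeConjecture.HodgeConjecture.Theorems.MarkmanPartnerTransportPicardThreeK3SquaresRMTypeOpenDescent
import HarnessLib

/-!
# Route MarkmanPartnerTransport · crux `PicardThreeK3Squares` (stmt-HodgeConjecture-19652) —
# (T′) BY NAME from the RM data: the eigenvalue and the eigenprojector certificate derived

Cell hodge-nonav, crux #4 (HC⁴(S ⊗ S), ρ(S) ≥ 3; open core: real multiplication), programme «RATIONAL ORBIT
DENSITY» (prover seat hodge-nonav-19652-p1 gen 10; `--supports stmt-HodgeConjecture-19652`, helper).
CONDITIONAL on the named facts `Buskin2019_hodgeIsometry_algebraic`, `Huybrechts_K3_periodSurjective_projective`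
and the DISPLAYED input `RMTypeOpen θ`; credits nothing; nothing here says HC is proved.

`…RMTypeOpenDescent.hodgeConjectureFor_square_of_rmTypeOpen` displays, beyond the binders of the cell's (T)
(`RMTypeDescent.hodgeConjectureFor_square_of_rmTypeDominated`, p620943), the `(2,0)`-eigenvalue `e ≠ 0` of the
generator and an eigenprojector certificate `π ∈ ℂ[X]` for `(θ, e)`. This file DERIVES both from the RM
datum `IsAnnihilatedOnTranscendentalBy S t P` for `P` SEPARABLE with `P(0) ≠ 0` (the shape of the minimal
polynomial of a generator of a totally real field `≠ ℚ`, e.g. `X³ − 3X + 1` for `ζ₉ + ζ₉⁻¹`):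

* `exists_eigenprojector_certificate` — `P ∈ ℂ[X]` separable, `P(e) = 0`, `P(f)·f = 0` ⟹ `π := P/(X − e)`
  normalised to `π(e) = 1` has `(f − e)·π(f)·f = 0` (pure algebra: `e` is a simple root);
* `star_eigenvalue_eq` — an eigenvalue of the real self-adjoint `θ_ℂ` on a period point (`(ȳ.y) ≠ 0`) is
  REAL;
* `conj_aeval_apply` — `σ η P(t) = P(θ_ℂ) σ η` along `σ η t = θ_ℂ σ η`;
* **`hodgeConjectureFor_square_of_rmTypeOpen_of_separable` — (T′) with EXACTLY the binders of (T), its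
  input `RMTypeDominated θ` replaced by the weaker `RMTypeOpen θ`, plus `P.Separable` and `P.eval 0 ≠ 0`**:
  the eigenvalue of `t` on `H^{2,0}(S)` is a root of `P` (the `(2,0)`-class is transcendental:
  `Huybrechts_K3_hodgeTypes_H2_holds` + graded commutativity), hence non-zero, and real; `t·P(t) = 0` on
  `H²(S)` because `t(H²) ⊥ N¹` (`ht_perp`) and `P(t)` kills transcendental classes; transported to
  `θ_ℂ·P(θ_ℂ) = 0` on `Λ_ℂ` (`σ` bijective), whence the certificate.

No definition, no sorry.

References: van Geemen–Schütt, Forum Math. Sigma 13 (2025) e2, §2.1, §3.4, §4.8; Buskin, J. reine angew.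
Math. 755 (2019), Thm. 1.1; Huybrechts, *Lectures on K3 Surfaces*, Ch. 6 Prop. 1.5, Rem. 3.3, Ch. 7
Thm. 4.1; Lang, *Algebra*, Ch. XIV §2–§3.
-/

set_option linter.dupNamespace false

noncomputable section

namespace Summit.HodgeConjecture.HodgeConjecture.Theorems.MarkmanPartnerTransport.RMTypeOrbit

open CategoryTheory MonoidalCategory Polynomial
open Literature.AlgebraicGeometry Literature.AlgebraicGeometry.Motives Literature.AlgebraicGeometry.HodgeTheory
open Literature.AlgebraicGeometry.Surfaces Literature.LinearAlgebra.QuadraticForm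
open Literature.AlgebraicTopology.SingularHomology
open Summit.HodgeConjecture.HodgeConjecture.Theorems.NikulinTwinTransport
open Summit.HodgeConjecture.HodgeConjecture.Theorems.MarkmanPartnerTransport.IsogenyInvariance
open Summit.HodgeConjecture.HodgeConjecture.Theorems.MarkmanPartnerTransport.RMTypeDescent

/-- `MarkedK3[S, η, p, x]`: VERBATIM the `let MarkedK3 := …` binder of the route declaration
`PicardThreeK3Squares` (as in `…RMTypeDescent`). Local notation only. -/
local notation3 (prettyPrint := false) "MarkedK3[" S ", " η ", " p ", " x "]" =>
  (p ≠ 0 ∧ (IsIntegralClass p ∧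
    (∀ q : complexBetti S (2 * 2), IsIntegralClass q → ∃ n : ℤ, q = n • p) ∧
    (∀ c : complexBetti S (2 * 1), IsIntegralClass c ↔ ∃ v : K3Index → ℤ, η c = fun i => (v i : ℂ)) ∧
    (∀ a b : complexBetti S (2 * 1),
      cupProduct (rfl : 2 * 1 + 2 * 1 = 2 * 2) a b = k3Form (η a) (η b) • p) ∧
    IsOfHodgeType 2 S (2 * 1) 2 0 (LinearEquiv.symm η x) ∧
    (∀ τ : complexBetti S (2 * 1), IsOfHodgeType 2 S (2 * 1) 2 0 τ →
      ∃ t : ℂ, τ = t • LinearEquiv.symm η x)) ∧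
    (k3Form x x = 0 ∧ 0 < (k3Form (star x) x).re ∧
      ∃ u : K3Index → ℤ, k3Form (fun i => (u i : ℂ)) x = 0 ∧ 0 < ∑ i, ∑ j, u i * k3Gram i j * u j))

/-- **Eigenprojector certificate from a separable annihilating polynomial.** If `P ∈ ℂ[X]` is separable,
`P(e) = 0` and `P(f)·f = 0`, then `π := P/(X − e)` normalised by `π(e) = 1` satisfies
`(f − e)·π(f)·f = 0`. [cite: Lang2002, Ch. XIV §2–§3 (primary decomposition)] -/
theorem exists_eigenprojector_certificate {V : Type*} [AddCommGroup V] [Module ℂ V] (f : Module.End ℂ V)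
    {P : ℂ[X]} (hP : P.Separable) (hf : aeval f (X * P) = 0) {e : ℂ} (he : P.IsRoot e) :
    ∃ π : ℂ[X], π.eval e = 1 ∧ ∀ y : V, f (aeval f π (f y)) = e • aeval f π (f y) := by
  have hP0 : P ≠ 0 := hP.ne_zero
  have hm : rootMultiplicity e P = 1 :=
    le_antisymm (rootMultiplicity_le_one_of_separable hP e) ((rootMultiplicity_pos hP0).2 he)
  set R := P /ₘ (X - C e) with hR
  have hRe : R.eval e ≠ 0 := by
    have h := eval_divByMonic_pow_rootMultiplicity_ne_zero e hP0
    rwa [hm, pow_one] at h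
  have hPR : (X - C e) * R = P := mul_divByMonic_eq_iff_isRoot.2 he
  refine ⟨C (R.eval e)⁻¹ * R, ?_, ?_⟩
  · rw [eval_mul, eval_C, inv_mul_cancel₀ hRe]
  · intro y
    have hpoly : (X - C e) * (C (R.eval e)⁻¹ * R) * X = C (R.eval e)⁻¹ * (X * P) := by
      rw [← hPR]; ring
    have h1 : aeval f ((X - C e) * (C (R.eval e)⁻¹ * R) * X) y = 0 := by
      rw [hpoly, map_mul, hf, mul_zero, LinearMap.zero_apply]
    rw [map_mul, map_mul, map_sub, aeval_X, aeval_C, Module.End.mul_apply, Module.End.mul_apply,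
      LinearMap.sub_apply, Module.algebraMap_end_apply] at h1
    rwa [← sub_eq_zero]

variable {θ : Matrix K3Index K3Index ℚ}

/-- **The `(2,0)`-eigenvalue of a real self-adjoint endomorphism is real**: if `θ_ℂ y = e y` for a vector
with `(ȳ.y) ≠ 0` (a period point) then `ē = e`. [cite: GeemenSchutt2023, §2.1 (E is totally real or CM)] -/
theorem star_eigenvalue_eq (hθsa : ∀ a b : K3Index → ℂ, k3Form (thetaC θ a) b = k3Form a (thetaC θ b))
    {e : ℂ} {y : K3Index → ℂ} (hy : thetaC θ y = e • y) (hpos : 0 < (k3Form (star y) y).re) :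
    star e = e := by
  have h1 := hθsa y (star y)
  rw [thetaC_star, hy, star_smul, k3Form_smul_left, k3Form_smul_right, k3Form_comm y (star y)] at h1
  have hne : k3Form (star y) y ≠ 0 := by
    intro h
    rw [h, Complex.zero_re] at hpos
    exact lt_irrefl _ hpos
  exact (mul_right_cancel₀ hne h1).symm

/-- Conjugation of polynomial expressions along `σ η t = θ_ℂ σ η`. [folklore] -/
theorem conj_aeval_apply {S : SchemeOver ℂ} (η : complexBetti S (2 * 1) ≃ₗ[ℂ] (K3Index → ℂ))
    (t : complexBetti S (2 * 1) →ₗ[ℂ] complexBetti S (2 * 1)) (σ : Module.End ℂ (K3Index → ℂ))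
    (hconj : ∀ c : complexBetti S (2 * 1), σ (η (t c)) = thetaC θ (σ (η c))) (Q : ℂ[X])
    (c : complexBetti S (2 * 1)) : σ (η (aeval t Q c)) = aeval (thetaC θ) Q (σ (η c)) := by
  have hpow : ∀ (k : ℕ) (c : complexBetti S (2 * 1)), σ (η ((t ^ k) c)) = (thetaC θ ^ k) (σ (η c)) := by
    intro k
    induction k with
    | zero => intro c; simp
    | succ k ih => intro c; rw [pow_succ', Module.End.mul_apply, hconj, ih, pow_succ', Module.End.mul_apply]
  rw [aeval_eq_sum_range, aeval_eq_sum_range, LinearMap.sum_apply, LinearMap.sum_apply, map_sum, map_sum]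
  refine Finset.sum_congr rfl fun k _ => ?_
  rw [LinearMap.smul_apply, LinearMap.smul_apply, map_smul, map_smul, hpow]

/-- **(T′) BY NAME with the RM data only** — as `hodgeConjectureFor_square_of_rmTypeOpen`, but the
`(2,0)`-eigenvalue and the eigenprojector certificate are DERIVED from the RM datum
`IsAnnihilatedOnTranscendentalBy S t P` for `P` SEPARABLE with `P(0) ≠ 0` (e.g. the minimal polynomial of a
generator of a totally real field): the eigenvalue `e` of `t` on `H^{2,0}(S)` is a root of `P` (the
`(2,0)`-class is transcendental), hence `≠ 0`, and is real (`θ` self-adjoint, `(x̄.x) > 0`); `θ_ℂ` is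
annihilated by `X·P` (transport of `t·P(t) = 0`, the latter since `t(H²) ⊂ T`), whence the certificate
`π = P/(X − e)` normalised. So: **the binders of p620943's (T) with `RMTypeDominated θ` replaced by
`RMTypeOpen θ`, plus `P.Separable` and `P.eval 0 ≠ 0`, give `HodgeConjectureFor 4 (S ⊗ S)`.** CONDITIONAL on
{`Buskin2019_hodgeIsometry_algebraic`, `Huybrechts_K3_periodSurjective_projective`} and `hOpen`; credits
nothing; HC is NOT proved here. [cite: GeemenSchutt2023, §2.1, §3.4 and §4.8] [cite: Buskin2019, Thm. 1.1]
[cite: Huybrechts2016K3, Ch. 6 Prop. 1.5, Rem. 3.3 and Ch. 7 Thm. 4.1] [cite: Lang2002, Ch. XIV §2–§3] -/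
theorem hodgeConjectureFor_square_of_rmTypeOpen_of_separable
    (hB : Buskin2019_hodgeIsometry_algebraic) (hPS : Huybrechts_K3_periodSurjective_projective)
    (hOpen : RMTypeOpen θ)
    (hθsa : ∀ a b : K3Index → ℂ, k3Form (thetaC θ a) b = k3Form a (thetaC θ b))
    {S : SchemeOver ℂ} {ρ : ℕ} {P : ℚ[X]} (h : IsRealMultiplicationK3 S ρ P)
    (hPsep : P.Separable) (hP0 : P.eval 0 ≠ 0)
    (η : complexBetti S (2 * 1) ≃ₗ[ℂ] (K3Index → ℂ)) (p : complexBetti S (2 * 2)) (x : K3Index → ℂ)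
    (hM : MarkedK3[S, η, p, x])
    (t : complexBetti S (2 * 1) →ₗ[ℂ] complexBetti S (2 * 1))
    (ht_rat : ∀ y, IsRationalClass y → IsRationalClass (t y))
    (ht_typ : ∀ (i j : ℕ) (y : complexBetti S (2 * 1)),
      IsOfHodgeType 2 S (2 * 1) i j y → IsOfHodgeType 2 S (2 * 1) i j (t y))
    (ht_N : ∀ d ∈ algebraicClasses S 1, t d = 0)
    (ht_perp : ∀ (y : complexBetti S (2 * 1)), ∀ d ∈ algebraicClasses S 1,
      cupProduct (rfl : 2 * 1 + 2 * 1 = 2 * 2) (t y) d = 0)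
    (hP : IsAnnihilatedOnTranscendentalBy S t P) (hgen : TranscendentalEndomorphismsGeneratedBy S t)
    (σ : Module.End ℂ (K3Index → ℂ)) (hσ : ∀ a b, k3Form (σ a) (σ b) = k3Form a b)
    (hσrat : ∀ v : K3Index → ℤ, ∃ w : K3Index → ℚ, σ (fun i => (v i : ℂ)) = fun i => (w i : ℂ))
    (hconj : ∀ c : complexBetti S (2 * 1), σ (η (t c)) = thetaC θ (σ (η c))) :
    HodgeConjectureFor 4 (S ⊗ S) := by
  classical
  have hS : IsK3Surface S := h.isK3Surface
  have hHT : Huybrechts_K3_hodgeTypes_H2 := Huybrechts_K3_hodgeTypes_H2_holds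
  obtain ⟨hp0, ⟨hpint, hpgen, hηint, hηcup, h20, hline⟩, hPer⟩ := hM
  have hxpos : 0 < (k3Form (star x) x).re := hPer.2.1
  have hx0 : η.symm x ≠ 0 := fun h0 =>
    ne_zero_of_star_self_re_pos hxpos (by simpa using congrArg η h0)
  -- the `(2,0)`-eigenvalue `e'` of `t`
  obtain ⟨e', he'⟩ := hline (t (η.symm x)) (ht_typ 2 0 _ h20)
  have heig' : thetaC θ (σ x) = e' • σ x := by
    have h1 := hconj (η.symm x)
    rw [he', map_smul, LinearEquiv.apply_symm_apply, map_smul] at h1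
    exact h1.symm
  -- `e'` is real
  have hPσ := periodPt_ratIsometry σ hσ hσrat hPer
  have hstar : star e' = e' := star_eigenvalue_eq hθsa heig' hPσ.2.1
  set e : ℝ := e'.re with hedef
  have hee : (e : ℂ) = e' := Complex.conj_eq_iff_re.1 hstar
  -- `e'` is a root of `P` (the `(2,0)`-class is transcendental)
  set PC : ℂ[X] := P.map (algebraMap ℚ ℂ) with hPC
  have htransc : ∀ d ∈ algebraicClasses S 1, cupProduct (rfl : 2 * 1 + 2 * 1 = 2 * 2) (η.symm x) d = 0 := by
    intro d hd
    obtain ⟨-, -, h3⟩ := hHT S hS (η.symm x) h20 hx0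
    have h11 : IsOfHodgeType 2 S (2 * 1) 1 1 d :=
      isOfHodgeType_of_mem_algebraicClasses_of_isSmoothProjective hS.isSmoothProjective 1 hd
    have hds := ((h3 d).1 h11).1
    rw [cupProduct_gradedComm_holds ℂ _ (rfl : 2 * 1 + 2 * 1 = 2 * 2) rfl]
    norm_num
    exact hds
  have hroot : PC.IsRoot e' := by
    have h1 := hP (η.symm x) htransc
    rw [← hPC, aeval_apply_of_eigen he', smul_eq_zero] at h1
    exact h1.resolve_right hx0
  have he0 : e ≠ 0 := by
    intro he0
    have h0 : e' = 0 := by rw [← hee, he0, Complex.ofReal_zero]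
    have h1 : PC.eval 0 = 0 := by
      have h2 : PC.eval e' = 0 := hroot
      rwa [h0] at h2
    rw [hPC, Polynomial.eval_map, Polynomial.eval₂_at_zero, map_eq_zero_iff _ (algebraMap ℚ ℂ).injective,
      Polynomial.coeff_zero_eq_eval_zero] at h1
    exact hP0 h1
  -- `θ_ℂ` is annihilated by `X·P`
  have htP : aeval t (X * PC) = 0 := by
    refine LinearMap.ext fun y => ?_
    rw [mul_comm X PC, map_mul, aeval_X, Module.End.mul_apply, LinearMap.zero_apply]
    exact hP (t y) (ht_perp y)
  have hσsurj : Function.Surjective σ :=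
    LinearMap.surjective_of_injective (injective_of_k3Form_isometry σ hσ)
  have hθP : aeval (thetaC θ) (X * PC) = 0 := by
    refine LinearMap.ext fun y => ?_
    obtain ⟨z, rfl⟩ := hσsurj y
    obtain ⟨c, rfl⟩ : ∃ c, η c = z := ⟨η.symm z, η.apply_symm_apply z⟩
    rw [LinearMap.zero_apply, ← conj_aeval_apply η t σ hconj, htP, LinearMap.zero_apply, map_zero, map_zero]
  -- the certificate, and the descent
  obtain ⟨π, hπe, hπW⟩ := exists_eigenprojector_certificate (thetaC θ) (hPsep.map) hθP hroot
  rw [← hee] at hπe hπW he'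
  exact hodgeConjectureFor_square_of_rmTypeOpen hB hPS hOpen hθsa he0 hπe hπW h η p x
    ⟨hp0, ⟨hpint, hpgen, hηint, hηcup, h20, hline⟩, hPer⟩ t ht_rat ht_N he' hgen σ hσ hσrat hconj

end Summit.HodgeConjecture.HodgeConjecture.Theorems.MarkmanPartnerTransport.RMTypeOrbit

end
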